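import Summits.RiemannHypothesis.RiemannHypothesis.Theorems.PfPersistenceF6PfC4FirstGap

/-!
# Pf-persistence, fake seat 6 (gen 4): the first-order FLAT-TRANSPORT law of the isomodular look-ahead twin

mechanism/rigidity campaign; no RH claims.

Setting (the in-model object of GAP-CLASSES row C8-N8(f6), l.1603, and of cand-8's row C8-N8 'fold + linear-response
anatomy'): a finite set `s` of in-window dials `q`, dial amplitudes `δ q`, and the Hellmann–Feynman first-order
responses of the bottom even level at the negative window `w` (`m q = u(w)ᵀ P_q u(w)`) and at the look-ahead window
`w⁺` (`m' q`).  ζ's bottom even levels are `e = e₁ᶻ(w) > 0` and `e' = e₁ᶻ(w⁺) > 0`.  To first order the perturbed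
levels are `firstOrderLevel s e δ m = e + ∑ δ q * m q` and `firstOrderLevel s e' δ m'`.

The flip equation at `w` (`e₁(w) = -x·e`, `x > 0`) fixes `∑ δ q * m q = -(1+x) e`.  If the SAME atoms respond at the
two neighbouring windows with comparable strength, `m' q = t q * m q` with `t q ∈ [1-η, 1+η]`, and the dial family
does not cancel (every term `δ q * m q` has the sign of the sum, i.e. is `≤ 0`), then the look-ahead level is
TRANSPORTED FLAT:
`e' - (1+η)(1+x) e ≤ e₁⁽¹⁾(w⁺) ≤ e' - (1-η)(1+x) e`, i.e. `ρ₁ := e₁⁽¹⁾(w⁺)/e' ∈ 1 - (1+x)·[1-η, 1+η]·(e/e')`.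
With the decay ratios of record `e/e' ≥ 1e4` this excludes the isomodular value `ρ = -1` at first order, and shows
that any first-order isomodular solution MUST CANCEL (some dial works against the flip at `w`) as soon as
`e/e' > 2/((1-η)(1+x))` — the typed form of cand-8's 'a forward twin reachable from ζ must let δP dominate the
deeper window' and of fake-6's law `ρ_land = -2T·e₁ᶻ(w)/e₁ᶻ(w⁺)`, `T ∈ [1-η, 1+η]` (DATA: `T = 1.010 … 1.505`).

HONEST SCOPE (DATA, fake-6 gen 4, 13 landing files): the LITERAL single-sign/banded class above does NOT contain the
row's min-norm landings — 2–4 of their 6–9 terms `δ q * m q` are positive (cancellation mass 20–50 % of `|∑ δ q * m q|`)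
and the near-edge response ratios `m' q / m q` range up to `1e11`.  What transports flat in the data is the `q = 2`
dominated signed mean (`T₁ = ∑ δ m' / ∑ δ m = 1.0026 … 1.0056`).  The landings ARE covered by the DEFECT form below
(`transport_sum_defect_le`, `flatTransport_defect_upper`, `flatTransport_defect_lock`), which needs no sign or band
hypothesis: for ANY reference factor `T₀`, `∑ δ q * m' q ≤ T₀ ∑ δ q * m q + R` with the dispersion
`R = ∑ |δ q| * |m' q - T₀ * m q|`; with `T₀ = m' 2 / m 2 ∈ [1.016, 1.038]` the measured relative dispersion is
`R / |∑ δ m| ≤ 0.34` at every landing, so `e₁⁽¹⁾(w⁺) ≤ e' - (T₀ - 0.34)(1+x) e < -e'` by the decay ratio `e/e' ≥ 3.2e4`.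

* `firstOrderLevel` — DEFINITION.
* `flip_sum_eq` — PROVED: the flip equation `firstOrderLevel s e δ m = -x e` ⇔ `∑ δ q * m q = -(1+x) e`.
* `transport_sum_le`, `transport_sum_ge` — PROVED: no-cancellation + response band ⇒
  `(1+η) S ≤ ∑ δ q * m' q ≤ (1-η) S` for `S = ∑ δ q * m q ≤ 0` termwise.
* `flatTransport_upper`, `flatTransport_lower` — PROVED: the two-sided flat-transport bound on `e₁⁽¹⁾(w⁺)`.
* `flatTransport_not_isomodular` — PROVED: if `(1-η)(1+x) e > 2 e'` then `e₁⁽¹⁾(w⁺) < -e'`, so `ρ₁ ≠ -1`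
  (indeed `ρ₁ < -1`).
* `cancellation_necessary` — PROVED: band + flip + first-order isomodularity `e₁⁽¹⁾(w⁺) = -e'` +
  `(1-η)(1+x) e > 2 e'` ⇒ some term `δ q * m q > 0`.
* `flatTransport_lock_instance` — PROVED closed instance with the numbers of record (`x = 1`, `η = 1/2`,
  `e ≥ 1e4 · e'`): `e₁⁽¹⁾(w⁺) ≤ -(1e4 - 1) e' < -e'`.
* `transport_sum_defect_le` — PROVED, hypothesis-free: `∑ δ q * m' q ≤ T₀ ∑ δ q * m q + ∑ |δ q| * |m' q - T₀ * m q|`.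
* `flatTransport_defect_upper` — PROVED: flip ⇒ `e₁⁽¹⁾(w⁺) ≤ e' - T₀ (1+x) e + R`.
* `flatTransport_defect_lock` — PROVED: flip, `R ≤ r (1+x) e` and `2 e' < (T₀ - r)(1+x) e` ⇒ `e₁⁽¹⁾(w⁺) < -e'`
  (the form the DATA instantiate: `T₀ ≈ 1.02`, `r ≤ 0.34`, `x = 1`, `e/e' ≥ 3.2e4`).

Everything is an elementary statement about finite real sums (levels and responses enter as hypotheses); nothing
refers to ζ, to the explicit formula, or to RH.  The second-order / fold behaviour of the rows is NOT claimed.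
[folklore]
-/

namespace Summit.RiemannHypothesis.RiemannHypothesis.Theorems.PfPersistence.F6

open Finset

variable {ι : Type*}

/-- DEFINITION: first-order (Hellmann–Feynman) bottom level: ζ's level plus the summed dial responses. -/
def firstOrderLevel (s : Finset ι) (e : ℝ) (δ m : ι → ℝ) : ℝ := e + ∑ q ∈ s, δ q * m q

/-- PROVED: unfolding lemma for `firstOrderLevel`. [folklore] -/
theorem firstOrderLevel_def (s : Finset ι) (e : ℝ) (δ m : ι → ℝ) :
    firstOrderLevel s e δ m = e + ∑ q ∈ s, δ q * m q := rfl

/-- PROVED: the flip equation at `w` in summed form. [folklore] -/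
theorem flip_sum_eq (s : Finset ι) (e x : ℝ) (δ m : ι → ℝ) :
    firstOrderLevel s e δ m = -x * e ↔ ∑ q ∈ s, δ q * m q = -(1 + x) * e := by
  unfold firstOrderLevel
  constructor <;> intro h <;> linarith

/-- PROVED: response band + no cancellation ⇒ the transported sum is at most `(1-η)` times the flip sum
(both sums are `≤ 0`). [folklore] -/
theorem transport_sum_le (s : Finset ι) (η : ℝ) (δ m m' t : ι → ℝ)
    (hband : ∀ q ∈ s, 1 - η ≤ t q) (hresp : ∀ q ∈ s, m' q = t q * m q)
    (hsign : ∀ q ∈ s, δ q * m q ≤ 0) :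
    ∑ q ∈ s, δ q * m' q ≤ (1 - η) * ∑ q ∈ s, δ q * m q := by
  rw [Finset.mul_sum]
  refine Finset.sum_le_sum fun q hq => ?_
  rw [hresp q hq]
  have h1 := hband q hq
  have h2 := hsign q hq
  nlinarith

/-- PROVED: response band + no cancellation ⇒ the transported sum is at least `(1+η)` times the flip sum. [folklore] -/
theorem transport_sum_ge (s : Finset ι) (η : ℝ) (δ m m' t : ι → ℝ)
    (hband : ∀ q ∈ s, t q ≤ 1 + η) (hresp : ∀ q ∈ s, m' q = t q * m q)
    (hsign : ∀ q ∈ s, δ q * m q ≤ 0) :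
    (1 + η) * ∑ q ∈ s, δ q * m q ≤ ∑ q ∈ s, δ q * m' q := by
  rw [Finset.mul_sum]
  refine Finset.sum_le_sum fun q hq => ?_
  rw [hresp q hq]
  have h1 := hband q hq
  have h2 := hsign q hq
  nlinarith

/-- PROVED (FLAT TRANSPORT, upper side): a non-cancelling first-order flip to `-x e` at `w` through atoms whose
look-ahead responses are within the band `[1-η, 1+η]` of their `w`-responses pushes the look-ahead bottom level down to
at most `e' - (1-η)(1+x) e`. [folklore] -/
theorem flatTransport_upper (s : Finset ι) (e e' x η : ℝ) (δ m m' t : ι → ℝ)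
    (hband : ∀ q ∈ s, 1 - η ≤ t q) (hresp : ∀ q ∈ s, m' q = t q * m q)
    (hsign : ∀ q ∈ s, δ q * m q ≤ 0) (hflip : firstOrderLevel s e δ m = -x * e) :
    firstOrderLevel s e' δ m' ≤ e' - (1 - η) * (1 + x) * e := by
  have hS := (flip_sum_eq s e x δ m).1 hflip
  have hT := transport_sum_le s η δ m m' t hband hresp hsign
  unfold firstOrderLevel
  rw [hS] at hT
  linarith

/-- PROVED (FLAT TRANSPORT, lower side). [folklore] -/
theorem flatTransport_lower (s : Finset ι) (e e' x η : ℝ) (δ m m' t : ι → ℝ)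
    (hband : ∀ q ∈ s, t q ≤ 1 + η) (hresp : ∀ q ∈ s, m' q = t q * m q)
    (hsign : ∀ q ∈ s, δ q * m q ≤ 0) (hflip : firstOrderLevel s e δ m = -x * e) :
    e' - (1 + η) * (1 + x) * e ≤ firstOrderLevel s e' δ m' := by
  have hS := (flip_sum_eq s e x δ m).1 hflip
  have hT := transport_sum_ge s η δ m m' t hband hresp hsign
  unfold firstOrderLevel
  rw [hS] at hT
  linarith

/-- PROVED (the LOCK at first order): if the decay ratio beats the band, `(1-η)(1+x) e > 2 e'`, then the transported
look-ahead level is below `-e'`: the first-order twin over-shoots the isomodular value `ρ = -1` (it has `ρ₁ < -1`).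
[folklore] -/
theorem flatTransport_not_isomodular (s : Finset ι) (e e' x η : ℝ) (δ m m' t : ι → ℝ)
    (hband : ∀ q ∈ s, 1 - η ≤ t q) (hresp : ∀ q ∈ s, m' q = t q * m q)
    (hsign : ∀ q ∈ s, δ q * m q ≤ 0) (hflip : firstOrderLevel s e δ m = -x * e)
    (hdecay : 2 * e' < (1 - η) * (1 + x) * e) :
    firstOrderLevel s e' δ m' < -e' := by
  have h := flatTransport_upper s e e' x η δ m m' t hband hresp hsign hflip
  linarith

/-- PROVED (CANCELLATION IS NECESSARY): under the response band, a first-order flip at `w` that is ALSO first-order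
isomodular at `w⁺` (`e₁⁽¹⁾(w⁺) = -e'`) with decay ratio `(1-η)(1+x) e > 2 e'` must contain a dial working AGAINST the
flip at `w` (`δ q * m q > 0` for some `q`). [folklore] -/
theorem cancellation_necessary (s : Finset ι) (e e' x η : ℝ) (δ m m' t : ι → ℝ)
    (hband : ∀ q ∈ s, 1 - η ≤ t q) (hresp : ∀ q ∈ s, m' q = t q * m q)
    (hflip : firstOrderLevel s e δ m = -x * e) (hiso : firstOrderLevel s e' δ m' = -e')
    (hdecay : 2 * e' < (1 - η) * (1 + x) * e) :
    ∃ q ∈ s, 0 < δ q * m q := by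
  by_contra hno
  have hsign : ∀ q ∈ s, δ q * m q ≤ 0 := fun q hq => not_lt.mp fun hpos => hno ⟨q, hq, hpos⟩
  have h := flatTransport_not_isomodular s e e' x η δ m m' t hband hresp hsign hflip hdecay
  linarith

/-- PROVED closed instance with the numbers of record: a full sign flip (`x = 1`), response band `η = 1/2`, and the
decay ratio `e ≥ 1e4 · e'` (every served pair `a₀ ≥ 1.05` has `e₁ᶻ(w)/e₁ᶻ(w⁺) ≥ 3.2e4`) give
`e₁⁽¹⁾(w⁺) ≤ e' - 1e4 · e' < -e'` for `e' > 0`. [folklore] -/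
theorem flatTransport_lock_instance (s : Finset ι) (e e' : ℝ) (δ m m' t : ι → ℝ)
    (he' : 0 < e') (hratio : (1e4 : ℝ) * e' ≤ e)
    (hband : ∀ q ∈ s, (1 : ℝ) - 1 / 2 ≤ t q) (hresp : ∀ q ∈ s, m' q = t q * m q)
    (hsign : ∀ q ∈ s, δ q * m q ≤ 0) (hflip : firstOrderLevel s e δ m = -1 * e) :
    firstOrderLevel s e' δ m' ≤ e' - (1e4 : ℝ) * e' ∧ firstOrderLevel s e' δ m' < -e' := by
  have h := flatTransport_upper s e e' 1 (1 / 2) δ m m' t hband hresp hsign hflip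
  constructor
  · nlinarith
  · nlinarith


/-- PROVED (hypothesis-free DEFECT form of the transport): for any reference factor `T₀`, the transported sum exceeds
`T₀` times the flip sum by at most the dispersion `∑ |δ q| * |m' q - T₀ * m q|`. [folklore] -/
theorem transport_sum_defect_le (s : Finset ι) (T₀ : ℝ) (δ m m' : ι → ℝ) :
    ∑ q ∈ s, δ q * m' q ≤ T₀ * ∑ q ∈ s, δ q * m q + ∑ q ∈ s, |δ q| * |m' q - T₀ * m q| := by
  rw [Finset.mul_sum, ← Finset.sum_add_distrib]
  refine Finset.sum_le_sum fun q _ => ?_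
  have h1 : δ q * m' q = T₀ * (δ q * m q) + δ q * (m' q - T₀ * m q) := by ring
  have h2 : δ q * (m' q - T₀ * m q) ≤ |δ q| * |m' q - T₀ * m q| := by
    rw [← abs_mul]; exact le_abs_self _
  linarith

/-- PROVED (FLAT TRANSPORT WITH DEFECT): a first-order flip to `-x e` at `w` gives, for any reference factor `T₀`,
`e₁⁽¹⁾(w⁺) ≤ e' - T₀ (1+x) e + R` with `R` the dispersion of the look-ahead responses around `T₀` times the
`w`-responses.  No sign or band hypothesis. [folklore] -/
theorem flatTransport_defect_upper (s : Finset ι) (e e' x T₀ : ℝ) (δ m m' : ι → ℝ)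
    (hflip : firstOrderLevel s e δ m = -x * e) :
    firstOrderLevel s e' δ m' ≤ e' - T₀ * (1 + x) * e + ∑ q ∈ s, |δ q| * |m' q - T₀ * m q| := by
  have hS := (flip_sum_eq s e x δ m).1 hflip
  have hT := transport_sum_defect_le s T₀ δ m m'
  unfold firstOrderLevel
  rw [hS] at hT
  linarith

/-- PROVED (the LOCK with defect): if the dispersion is at most the fraction `r` of the flip depth, `R ≤ r (1+x) e`, and
the decay ratio beats what is left, `2 e' < (T₀ - r)(1+x) e`, then the first-order look-ahead level is below `-e'`
(`ρ₁ < -1`): the isomodular value is over-shot.  This is the form the row's landings instantiate (DATA: `T₀ ≈ 1.02`,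
`r ≤ 0.34`, `x = 1`, `e/e' ≥ 3.2e4`). [folklore] -/
theorem flatTransport_defect_lock (s : Finset ι) (e e' x T₀ r : ℝ) (δ m m' : ι → ℝ)
    (hflip : firstOrderLevel s e δ m = -x * e)
    (hR : ∑ q ∈ s, |δ q| * |m' q - T₀ * m q| ≤ r * (1 + x) * e)
    (hdecay : 2 * e' < (T₀ - r) * (1 + x) * e) :
    firstOrderLevel s e' δ m' < -e' := by
  have h := flatTransport_defect_upper s e e' x T₀ δ m m' hflip
  nlinarith

end Summit.RiemannHypothesis.RiemannHypothesis.Theorems.PfPersistence.F6
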